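import Literature.IUT.HodgeTheaters.PuncturedEllipticArrowModelDatum
import Literature.IUT.HodgeTheaters.PuncturedEllipticArrowModelUnorientedLaws
import HarnessLib

/-!
# The unoriented variant of the [IUTchI] §1 model, part 3: ALL typed §1 predicates hold AND `I_{ε⁰} ⊆ Π_{X̲→}` — the `ε⁰`-ramification clause is independent (witness)

Mochizuki, *Inter-universal Teichmüller theory I*, kurims manuscript (May 2020), §1 pp. 37–39, proof of
Corollary 1.2 p. 39: «the decomposition groups of `ε⁰, ε′, ε″` … whose image in
`Gal(X̲→/X̲) = Π_X̲/Π_{X̲→}` is nontrivial» ([IUTchI] Cor 1.2 p.39) [claim: Mochizuki2012, status: disputed]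
(D-0012 claim key; series status DISPUTED — WITNESS-class module: two finite models; nothing of the series is
asserted, no side is taken on [IUTchIII] Cor. 3.12).

THE «t1 READING» OF GAP-LEDGER ROW G-L5d4g6-1 (abc-iut-L5-t1 lineage, owner of the §1 interface), IN THE
KERNEL.  abc-iut-L5-d4's assembly `PuncturedEllipticData.characteristicNatureOfCoverings_of_anabelian`
(`PuncturedEllipticCoveringsCor12Assembly.lean`) carries the printed clause for `ε⁰` as the binder
`h0 : ¬ D.inertia D.ε0 ≤ D.piXarrow`.  Here:
* `ArrowModel.udatum` — the model `Π_C = N ⋊ D_l` (`G_k = 1`) with the UNORIENTED inertia `c′_i = B_i + B_{i+1}`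
  packaged as a `PuncturedEllipticData`; the §1 construction computed in it gives the SAME
  `jKer = K`, `Π_{X̲→} = K`, `Π_{C̲→} = K′` as the genuine model (`udatum_jKer`, `udatum_piXarrow`, …);
* `udatum_arrowCoveringClaims`, `udatum_rmk121`, `udatumCuspGalois`, `udatum_arrowOpenClaims`,
  `udatum_numerics` — EVERY typed §1 predicate holds for it, exactly as for the genuine datum;
* `udatum_inertia_ε0_le_piXarrow` — but `I_{ε⁰} ⊆ Π_{X̲→}`: the zero cusp is UNRAMIFIED in `X̲→ → X̲`;
* `datum_not_inertia_ε0_le_piXarrow` — whereas the genuine datum `ArrowModel.datum` satisfies `h0`;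
* `inertia_ε0_clause_independent` — hence NEITHER `h0` NOR `¬ h0` follows from
  `ArrowCoveringClaims ∧ Rmk121 ∧ ArrowOpenClaims ∧ CuspGalois ∧` (Def. 3.1 (d) numerics): the GAP row is
  correctly classed «independent printed hypothesis»; the deciding print input is the surface relation for
  cyclotomically ORIENTED cusp-inertia generators of `Δ_X̲` plus «`ι̲` preserves the orientation of
  `I_{ε⁰}`» (étale-π₁-of-curves structure; INTERFACE, TODO-merge abc-iut-L4-t1), to be supplied as a law at
  the genuine instantiation — until then `h0` stays a binder (no restatement needed).
No `sorry`, no instance declared, symbolic `l`; axioms standard.  Witnessed ≠ endorsed.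
-/

namespace Literature.IUT.HodgeTheaters

namespace PuncturedEllipticData

namespace ArrowModel

open Literature.AnabelianGeometry.AbsoluteAnabelian DihedralGroup
open scoped Pointwise

variable (l : ℕ)

/-! ### The unoriented datum -/

/-- **The unoriented §1 model datum** (`l ≥ 5` prime to `6`): as `ArrowModel.datum` (`Π_C = N ⋊ D_l ↠ 1`,
`Π_X = N ⋊ ⟨r⟩`, `Π_C̲ = N ⋊ ⟨s⟩`, cusps `ℤ/l`, `ε⁰, ε′, ε″, 2ε := 0, 1, −1, 2`) but with decomposition groups
`D′_i = ⟨(c′_i, 1)⟩`, `c′_i = B_i + B_{i+1}`. ([IUTchI] §1 p.37) [claim: Mochizuki2012, status: disputed] -/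
noncomputable abbrev udatum (h5 : 5 ≤ l) (h6 : Nat.Coprime l 6) : PuncturedEllipticData.{0} :=
  haveI : NeZero l := ⟨by omega⟩
  { l := l
    five_le := h5
    coprime_six := h6
    E := ext l
    PiX := PiXm l
    PiCbar := PiCbarm l
    isOpen_piX := @isOpen_discrete _ _ (discreteTopology_arithGrp l) _
    isOpen_piCbar := @isOpen_discrete _ _ (discreteTopology_arithGrp l) _
    index_piX := index_PiXm l
    aug_piX := fun _ => ⟨1, Subsingleton.elim _ _⟩
    aug_piCbar := fun _ => ⟨1, Subsingleton.elim _ _⟩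
    star := by
      intro g hg x hx
      have hg' : g ∈ PiXm l ⊓ (ext l).geom := ⟨hg, by rw [geom_eq_top]; trivial⟩
      refine Subgroup.le_topologicalClosure _ (Subgroup.mem_sup_left ?_)
      rw [← commutatorElement_def]
      exact Subgroup.commutator_mem_commutator hg' hx
    Cusp := ZMod l
    decomp := Du l
    decomp_le := fun i g hg => by
      have h : g ∈ PiXm l ⊓ PiCbarm l := by rw [PiXm_inf_PiCbarm]; exact Du_le_Nhat l i hg
      exact h
    ε0 := 0
    ε1 := 1
    ε2 := -1
    twoε := 2
    ε1_ne_ε0 := (cusp_facts_of_five_le l h5).1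
    ε2_ne_ε0 := (cusp_facts_of_five_le l h5).2.1
    ε1_ne_ε2 := (cusp_facts_of_five_le l h5).2.2.1
    twoε_ne := (cusp_facts_of_five_le l h5).2.2.2
    aug_decomp_twoε := fun _ => ⟨1, Subsingleton.elim _ _⟩ }

/-! ### The §1 construction computed in the unoriented model: the SAME `K`, `K′` -/

section Identify

variable {l} (h5 : 5 ≤ l) (h6 : Nat.Coprime l 6)

/-- `Π_X̲ = N`. [claim: Mochizuki2012, status: disputed] -/
theorem udatum_piXbar : (udatum l h5 h6).PiXbar = Nhat l := PiXm_inf_PiCbarm l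

/-- `Δ_C = Π_C`. [claim: Mochizuki2012, status: disputed] -/
theorem udatum_deltaC : (udatum l h5 h6).DeltaC = ⊤ := by
  haveI : NeZero l := ⟨by omega⟩
  exact geom_eq_top l

/-- `Δ_X̲ = N`. [claim: Mochizuki2012, status: disputed] -/
theorem udatum_deltaXbar : (udatum l h5 h6).DeltaXbar = Nhat l := by
  show (udatum l h5 h6).PiXbar ⊓ (udatum l h5 h6).DeltaC = _
  rw [udatum_deltaC, inf_top_eq, udatum_piXbar]

/-- `Δ_C̲ = Π_C̲`. [claim: Mochizuki2012, status: disputed] -/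
theorem udatum_deltaCbar : (udatum l h5 h6).DeltaCbar = PiCbarm l := by
  show (udatum l h5 h6).PiCbar ⊓ (udatum l h5 h6).DeltaC = _
  rw [udatum_deltaC, inf_top_eq]

/-- `I_x = D′_x` (`G_k = 1`). [claim: Mochizuki2012, status: disputed] -/
theorem udatum_inertia (x : ZMod l) : (udatum l h5 h6).inertia x = Du l x := by
  show (udatum l h5 h6).decomp x ⊓ (udatum l h5 h6).DeltaC = _
  rw [udatum_deltaC, inf_top_eq]

/-- `modLKer = 1`. ([IUTchI] §1 p.37) [claim: Mochizuki2012, status: disputed] -/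
theorem udatum_modLKer : (udatum l h5 h6).modLKer = ⊥ := by
  haveI : NeZero l := ⟨by omega⟩
  refine le_antisymm ?_ bot_le
  unfold PuncturedEllipticData.modLKer
  refine Subgroup.topologicalClosure_minimal _ (sup_le ?_ ?_)
    (@isClosed_discrete _ _ (discreteTopology_arithGrp l) _)
  · rw [udatum_deltaXbar]
    exact le_of_eq (commutator_Nhat_eq_bot l)
  · rw [udatum_deltaXbar]
    exact le_of_eq (closure_pow_Nhat_eq_bot l)

/-- `deltaEpsKer = ⨆_{x ∉ {0, ±1}} D′_x`. ([IUTchI] §1 p.37) [claim: Mochizuki2012, status: disputed] -/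
theorem udatum_deltaEpsKer : (udatum l h5 h6).deltaEpsKer = EpsSupU l := by
  show (udatum l h5 h6).modLKer ⊔ (⨆ x : {x : ZMod l // x ≠ 0 ∧ x ≠ 1 ∧ x ≠ -1},
    (udatum l h5 h6).inertia x.1) = _
  rw [udatum_modLKer, bot_sup_eq]
  exact iSup_congr fun x => udatum_inertia h5 h6 x.1

/-- **`jKer = K`** in the unoriented model — the same subgroup as in the genuine one. ([IUTchI] §1 p.38)
[claim: Mochizuki2012, status: disputed] -/
theorem udatum_jKer : (udatum l h5 h6).jKer = Khat l := by
  haveI : NeZero l := ⟨by omega⟩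
  obtain ⟨q, hq⟩ := odd_of_coprime_six h6
  show (udatum l h5 h6).deltaEpsKer ⊔ Subgroup.closure {z | ∃ x ∈ (udatum l h5 h6).DeltaXbar,
    ∃ c ∈ (udatum l h5 h6).DeltaCbar, c ∉ (udatum l h5 h6).DeltaXbar ∧ z = x * c * x⁻¹ * c⁻¹} = _
  rw [udatum_deltaEpsKer, udatum_deltaXbar, udatum_deltaCbar]
  exact supU_closure_commSet_eq_Khat l hq (by omega)

/-- **`Π_{X̲→} = K`**. ([IUTchI] §1 p.38) [claim: Mochizuki2012, status: disputed] -/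
theorem udatum_piXarrow : (udatum l h5 h6).piXarrow = Khat l := by
  show (udatum l h5 h6).decomp 2 ⊔ (udatum l h5 h6).jKer = _
  rw [udatum_jKer]
  exact sup_eq_right.mpr
    (Du_le_Khat l (cusp_facts_of_five_le l h5).2.2.2.2.1 (cusp_facts_of_five_le l h5).2.2.2.2.2)

/-- **`galKer = K′`**. ([IUTchI] §1 p.38) [claim: Mochizuki2012, status: disputed] -/
theorem udatum_galKer : (udatum l h5 h6).galKer = Khat' l := by
  obtain ⟨q, hq⟩ := odd_of_coprime_six h6
  show (udatum l h5 h6).jKer ⊔ Subgroup.closure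
    ((fun y : (udatum l h5 h6).PiC => y ^ l) '' ((udatum l h5 h6).DeltaCbar : Set _)) = _
  rw [udatum_jKer, udatum_deltaCbar]
  exact Khat_sup_closure_powSet_eq l hq

/-- **`Π_{C̲→} = K′`**. ([IUTchI] §1 p.38) [claim: Mochizuki2012, status: disputed] -/
theorem udatum_piCarrow : (udatum l h5 h6).piCarrow = Khat' l := by
  show (udatum l h5 h6).decomp 2 ⊔ (udatum l h5 h6).galKer = _
  rw [udatum_galKer]
  exact sup_eq_right.mpr ((Du_le_Khat l (cusp_facts_of_five_le l h5).2.2.2.2.1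
    (cusp_facts_of_five_le l h5).2.2.2.2.2).trans (Khat_le_Khat' l))

end Identify

/-! ### ALL the typed §1 predicates hold in the unoriented model -/

section Claims

variable {l} (h5 : 5 ≤ l) (h6 : Nat.Coprime l 6)

/-- **`ArrowCoveringClaims` holds for the unoriented datum** — every clause of pp. 37–38 as typed.
([IUTchI] §1 p.38) [claim: Mochizuki2012, status: disputed] -/
theorem udatum_arrowCoveringClaims : (udatum l h5 h6).ArrowCoveringClaims := by
  haveI : NeZero l := ⟨by omega⟩
  have h2 : 2 ≤ l := by omega
  have h3 : 3 ≤ l := by omega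
  have hodd := odd_of_coprime_six h6
  have cycX : ∀ P : Subgroup (G l), P = Khat l →
      ∀ [(P.subgroupOf (PiCbarm l)).Normal], IsCyclic (PiCbarm l ⧸ P.subgroupOf (PiCbarm l)) := by
    rintro P rfl _; exact isCyclic_quot_Khat l h2 hodd
  have cycC : ∀ P : Subgroup (G l), P = Khat' l →
      ∀ [(P.subgroupOf (PiCbarm l)).Normal], IsCyclic (PiCbarm l ⧸ P.subgroupOf (PiCbarm l)) := by
    rintro P rfl _; exact isCyclic_quot_Khat' l h2
  exact
  { jKer_normal := by rw [udatum_jKer]; exact normal_Khat_subgroupOf_PiCbarm l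
    jKer_relindex := by rw [udatum_jKer, udatum_deltaXbar]; exact relIndex_Khat_Nhat l h2
    inertia_ε1_sup := by rw [udatum_inertia, udatum_jKer, udatum_deltaXbar]; exact Du_one_sup_Khat l h3
    inertia_ε2_sup := by
      rw [udatum_inertia, udatum_jKer, udatum_deltaXbar]; exact Du_neg_one_sup_Khat l h3
    piXarrow_inf_delta := by rw [udatum_piXarrow, udatum_deltaC, inf_top_eq, udatum_jKer]
    aug_piXarrow := fun _ => ⟨1, Subsingleton.elim _ _⟩
    cartesian := by rw [udatum_piXarrow, udatum_piXbar, udatum_piCarrow]; exact (Nhat_inf_Khat' l).symm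
    piXarrow_normal := by rw [udatum_piXarrow]; exact normal_Khat_subgroupOf_PiCbarm l
    piCarrow_normal := by rw [udatum_piCarrow]; exact normal_Khat'_subgroupOf_PiCbarm l
    piXarrow_relindex := by rw [udatum_piXarrow]; exact relIndex_Khat_PiCbarm l h2
    piCarrow_relindex := by rw [udatum_piCarrow]; exact relIndex_Khat'_PiCbarm l h2
    galX_cyclic := @cycX _ (udatum_piXarrow h5 h6)
    galC_cyclic := @cycC _ (udatum_piCarrow h5 h6) }

/-- **Remark 1.2.1 holds for the unoriented datum**. ([IUTchI] Rmk 1.2.1 p.40) [claim: Mochizuki2012, status: disputed] -/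
theorem udatum_rmk121 : (udatum l h5 h6).Rmk121 := by
  haveI : NeZero l := ⟨by omega⟩
  have h2 : 2 ≤ l := by omega
  have h3 : 3 ≤ l := by omega
  exact
  { normalizer_piXarrow := by rw [udatum_piXarrow]; exact normalizer_Khat l h3
    normalizer_piCarrow := by rw [udatum_piCarrow]; exact normalizer_Khat' l h3
    card_galX := by rw [udatum_piXarrow]; exact relIndex_Khat_PiCbarm l h2
    card_galC := by rw [udatum_piCarrow]; exact relIndex_Khat'_PiCbarm l h2 }

/-- **The unoriented datum carries the companion `CuspGalois` structure** (cusp action through `D_l`; `ι̲ = s`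
fixes `ε⁰ = 0`, switches `ε′, ε″ = ±1`). ([IUTchI] §1 p.37) [claim: Mochizuki2012, status: disputed] -/
noncomputable def udatumCuspGalois : (udatum l h5 h6).CuspGalois :=
  haveI : NeZero l := ⟨by omega⟩
  { act := actm l
    act_decomp := act_decomp_auxU l
    eq_of_conj := eq_of_conj_auxU l (by omega)
    isClosed_decomp := fun _ => @isClosed_discrete _ _ (discreteTopology_arithGrp l) _
    free := free_aux l
    transitive := transitive_aux l
    exists_generator := generator_aux l
    conj_mul_mem_PiXbar := conj_aux l
    act_ε0 := act0_aux l
    act_ε1 := act1_aux l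
    act_twoε := act2_aux l }

/-- The unoriented datum satisfies `ArrowOpenClaims` (discrete topology). ([IUTchI] §1 p.38)
[claim: Mochizuki2012, status: disputed] -/
theorem udatum_arrowOpenClaims : (udatum l h5 h6).ArrowOpenClaims := by
  haveI : NeZero l := ⟨by omega⟩
  exact ⟨@isOpen_discrete _ _ (discreteTopology_arithGrp l) _,
    @isOpen_discrete _ _ (discreteTopology_arithGrp l) _⟩

/-- The Def. 3.1 (d) numerics for the unoriented datum: `[Π_X : Π_X̲] = l`, `[Π_C̲ : Π_X̲] = 2`, `Π_C̲ ⊄ Π_X`,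
`Π_X̲ ↠ G_k`. ([IUTchI] Def 3.1(d) p.62) [claim: Mochizuki2012, status: disputed] -/
theorem udatum_numerics :
    (udatum l h5 h6).PiXbar.relIndex (udatum l h5 h6).PiX = l ∧
      (udatum l h5 h6).PiXbar.relIndex (udatum l h5 h6).PiCbar = 2 ∧
      ¬ (udatum l h5 h6).PiCbar ≤ (udatum l h5 h6).PiX ∧
      Function.Surjective ((udatum l h5 h6).E.aug.toMonoidHom.comp (udatum l h5 h6).PiXbar.subtype) := by
  haveI : NeZero l := ⟨by omega⟩
  exact ⟨relIndex_inf_PiXm l, relIndex_inf_PiCbarm l, not_PiCbarm_le_PiXm l,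
    fun _ => ⟨1, Subsingleton.elim _ _⟩⟩

/-! ### The `ε⁰`-clause: FALSE in the unoriented model, TRUE in the genuine one -/

/-- **`I_{ε⁰} ⊆ Π_{X̲→}` in the unoriented model**: the zero cusp is UNRAMIFIED in `X̲→ → X̲` although every
typed §1 predicate holds. ([IUTchI] Cor 1.2 p.39) [claim: Mochizuki2012, status: disputed] -/
theorem udatum_inertia_ε0_le_piXarrow :
    (udatum l h5 h6).inertia (udatum l h5 h6).ε0 ≤ (udatum l h5 h6).piXarrow := by
  show (udatum l h5 h6).inertia 0 ≤ _
  rw [udatum_inertia, udatum_piXarrow]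
  exact Du_zero_le_Khat l (by omega)

/-- **`¬ I_{ε⁰} ⊆ Π_{X̲→}` in the GENUINE model** `ArrowModel.datum` (`ℓ(c_0) = −2 ≠ 0`): there the printed
clause holds. ([IUTchI] Cor 1.2 p.39) [claim: Mochizuki2012, status: disputed] -/
theorem datum_not_inertia_ε0_le_piXarrow :
    ¬ (datum l h5 h6).inertia (datum l h5 h6).ε0 ≤ (datum l h5 h6).piXarrow := by
  show ¬ (datum l h5 h6).inertia 0 ≤ _
  rw [inertia_eq, piXarrow_eq]
  exact not_Dm_zero_le_Khat l (by omega)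

end Claims

/-! ### Independence of the `ε⁰`-ramification clause from the typed §1 record -/

/-- **JOINT MODEL WITH `I_{ε⁰} ⊆ Π_{X̲→}`**: for every `l ≥ 5` prime to `6` there is a `PuncturedEllipticData`
with that `l` satisfying SIMULTANEOUSLY `ArrowCoveringClaims`, `Rmk121`, `ArrowOpenClaims`, carrying a
`CuspGalois` structure, meeting the Def. 3.1 (d) numerics — AND with the zero cusp unramified in
`X̲→ → X̲`. ([IUTchI] Cor 1.2 p.39) [claim: Mochizuki2012, status: disputed] -/
theorem exists_sectionOne_model_inertia_ε0_le (h5 : 5 ≤ l) (h6 : Nat.Coprime l 6) :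
    ∃ D : PuncturedEllipticData.{0}, D.l = l ∧ D.ArrowCoveringClaims ∧ D.Rmk121 ∧ D.ArrowOpenClaims ∧
      Nonempty D.CuspGalois ∧ D.PiXbar.relIndex D.PiX = l ∧ D.PiXbar.relIndex D.PiCbar = 2 ∧
      ¬ D.PiCbar ≤ D.PiX ∧ Function.Surjective (D.E.aug.toMonoidHom.comp D.PiXbar.subtype) ∧
      D.inertia D.ε0 ≤ D.piXarrow :=
  ⟨udatum l h5 h6, rfl, udatum_arrowCoveringClaims h5 h6, udatum_rmk121 h5 h6, udatum_arrowOpenClaims h5 h6,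
    ⟨udatumCuspGalois h5 h6⟩, (udatum_numerics h5 h6).1, (udatum_numerics h5 h6).2.1,
    (udatum_numerics h5 h6).2.2.1, (udatum_numerics h5 h6).2.2.2, udatum_inertia_ε0_le_piXarrow h5 h6⟩

/-- **JOINT MODEL WITH `¬ I_{ε⁰} ⊆ Π_{X̲→}`** (the genuine `ArrowModel.datum`). ([IUTchI] Cor 1.2 p.39)
[claim: Mochizuki2012, status: disputed] -/
theorem exists_sectionOne_model_not_inertia_ε0_le (h5 : 5 ≤ l) (h6 : Nat.Coprime l 6) :
    ∃ D : PuncturedEllipticData.{0}, D.l = l ∧ D.ArrowCoveringClaims ∧ D.Rmk121 ∧ D.ArrowOpenClaims ∧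
      Nonempty D.CuspGalois ∧ D.PiXbar.relIndex D.PiX = l ∧ D.PiXbar.relIndex D.PiCbar = 2 ∧
      ¬ D.PiCbar ≤ D.PiX ∧ Function.Surjective (D.E.aug.toMonoidHom.comp D.PiXbar.subtype) ∧
      ¬ D.inertia D.ε0 ≤ D.piXarrow :=
  ⟨datum l h5 h6, rfl, arrowCoveringClaims h5 h6, rmk121 h5 h6, arrowOpenClaims h5 h6,
    ⟨cuspGalois h5 h6⟩, (thetaNumerics h5 h6).1, (thetaNumerics h5 h6).2.1,
    (thetaNumerics h5 h6).2.2.1, (thetaNumerics h5 h6).2.2.2, datum_not_inertia_ε0_le_piXarrow h5 h6⟩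

/-- **INDEPENDENCE of the `ε⁰`-ramification clause** (GAP-LEDGER G-L5d4g6-1, t1 reading): the typed §1 record
— `ArrowCoveringClaims ∧ Rmk121 ∧ ArrowOpenClaims ∧ CuspGalois ∧` the Def. 3.1 (d) numerics — decides
NEITHER `¬ I_{ε⁰} ⊆ Π_{X̲→}` (the binder `h0` of `characteristicNatureOfCoverings_of_anabelian`) NOR its
negation: both have models, at every admissible `l`.  (So `h0` is an independent printed hypothesis, to be
proved at the genuine étale-π₁ instantiation from the oriented surface relation; finite models, `G_k = 1`.)
([IUTchI] Cor 1.2 p.39) [claim: Mochizuki2012, status: disputed] -/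
theorem inertia_ε0_clause_independent (h5 : 5 ≤ l) (h6 : Nat.Coprime l 6) :
    (∃ D : PuncturedEllipticData.{0}, D.l = l ∧ D.ArrowCoveringClaims ∧ D.Rmk121 ∧ D.ArrowOpenClaims ∧
      Nonempty D.CuspGalois ∧ D.PiXbar.relIndex D.PiX = l ∧ D.PiXbar.relIndex D.PiCbar = 2 ∧
      ¬ D.PiCbar ≤ D.PiX ∧ Function.Surjective (D.E.aug.toMonoidHom.comp D.PiXbar.subtype) ∧
      D.inertia D.ε0 ≤ D.piXarrow) ∧
    (∃ D : PuncturedEllipticData.{0}, D.l = l ∧ D.ArrowCoveringClaims ∧ D.Rmk121 ∧ D.ArrowOpenClaims ∧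
      Nonempty D.CuspGalois ∧ D.PiXbar.relIndex D.PiX = l ∧ D.PiXbar.relIndex D.PiCbar = 2 ∧
      ¬ D.PiCbar ≤ D.PiX ∧ Function.Surjective (D.E.aug.toMonoidHom.comp D.PiXbar.subtype) ∧
      ¬ D.inertia D.ε0 ≤ D.piXarrow) :=
  ⟨exists_sectionOne_model_inertia_ε0_le l h5 h6, exists_sectionOne_model_not_inertia_ε0_le l h5 h6⟩

/-- **The clause is NOT a theorem of the typed record**: it is false that every `PuncturedEllipticData`
satisfying all typed §1 predicates has `¬ I_{ε⁰} ⊆ Π_{X̲→}` (counter-model at `l = 5`).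
([IUTchI] Cor 1.2 p.39) [claim: Mochizuki2012, status: disputed] -/
theorem not_forall_inertia_ε0_ramified :
    ¬ ∀ D : PuncturedEllipticData.{0}, D.ArrowCoveringClaims → D.Rmk121 → D.ArrowOpenClaims →
      Nonempty D.CuspGalois → D.PiXbar.relIndex D.PiX = D.l → D.PiXbar.relIndex D.PiCbar = 2 →
      ¬ D.PiCbar ≤ D.PiX → ¬ D.inertia D.ε0 ≤ D.piXarrow := by
  intro H
  obtain ⟨D, hl, hA, hR, hO, hC, hX, h2, hn, -, h0⟩ :=
    exists_sectionOne_model_inertia_ε0_le 5 le_rfl (by decide)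
  exact H D hA hR hO hC (by rw [hX, hl]) h2 hn h0

end ArrowModel

end PuncturedEllipticData

end Literature.IUT.HodgeTheaters
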